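import Literature.RepresentationTheory.HeisenbergGroup.SchrodingerDirectSum
import Literature.RepresentationTheory.HeisenbergGroup.SchrodingerLeraySectionGram
import Literature.RepresentationTheory.HeisenbergGroup.ImplementerCocycle
import Literature.LinearAlgebra.TensorProductCommutant
import HarnessLib

/-!
# Sum-stripping at a finite place: an implementer of `g₁ ⊕ 1` on `𝒮(K^ι) = 𝒮(K^{ι₁}) ⊗ 𝒮(K^{ι₂})` IS `M₁ ⊠ 1`

Topic `RepresentationTheory/HeisenbergGroup`; namespace `Literature.RepresentationTheory.HeisenbergGroup`. KERNEL
MATHEMATICS ONLY: every declaration is proved; no `def … : Prop` record, no `axiom`, no cited hypothesis. The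
single-place twin of the tree's `Weil1964/AdelicMetaplecticSumStripping(Hom)` (there: adelic, with an archimedean
factor; here: one non-archimedean place, no archimedean factor, no topology on the groups of pairs).

Setting: a non-archimedean local field `K` (`2` invertible), an enumeration `e : ι₁ ⊕ ι₂ ≃ ι`, Gram matrices
`T₁, T₂` and `T = reindex e e (T₁ ⊕ T₂)` (`hT`) with `det T₂` a unit, a non-trivial continuous character `ψ`,
the smooth Schrödinger models `ρ_T, ρ_{T₁}, ρ_{T₂}` (`schrodingerSB`) on `𝒮(K^ι), 𝒮(K^{ι₁}), 𝒮(K^{ι₂})`, MVW's groups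
of pairs `S̃p_ψ = MpPsi ρ`, and the embedding `spInl : Sp(W_{T₁}) →* Sp(W_T)`, `g₁ ↦ g₁ ⊕ 1`
(`SchrodingerDirectSum`).

* §1 **Schur for `ρ_{T₂}`** (`commutant_schrodingerSB_gram`): a linear endomorphism of `𝒮(K^{ι₂})` commuting with
  every `ρ_{T₂}(h)` is a scalar — transport of the tree's `commutant_schrodingerSB_pi` [MoeglinVignerasWaldspurger1987,
  Chap. 2 I.3] along `(x, y) ↦ (x, T₂ y)` (`schrodingerSB_gram_eq`).
* §2 **stripping** (`exists_strip_boxSB`): an implementer `M` of `g₁ ⊕ 1` on `𝒮(K^ι)` commutes with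
  `ρ_T(inrH h₂) = 1 ⊠ ρ_{T₂}(h₂)`, hence `M (f₁ ⊠ f₂) = B₁ f₁ ⊠ f₂` by the algebraic tensor-commutant lemma
  `LinearAlgebra.exists_tmul_eq_of_commute_lTensor`; with `M⁻¹` stripped too, `B₁` is invertible and IMPLEMENTS `g₁`
  for `ρ_{T₁}` (`⊠ f₂`-cancellation against `ρ_T(inlH h₁)(f₁ ⊠ f₂) = ρ_{T₁}(h₁) f₁ ⊠ f₂`): the main theorem
  `exists_strip_of_proj_eq_spInl` — **for `(G, M) ∈ S̃p_ψ(W_T)` over `G = g₁ ⊕ 1` there is `(g₁, M₁) ∈ S̃p_ψ(W_{T₁})`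
  with `M (f₁ ⊠ f₂) = M₁ f₁ ⊠ f₂`**, unique (`strip_unique`) [MoeglinVignerasWaldspurger1987, Chap. 2 II.1 Rem. (6);
  Weil1964, Chap. III n° 37–38].
* §3 the subgroup `leftSummandMp ≤ S̃p_ψ(W_T)` over `Sp(W_{T₁}) ⊕ 1`, the STRIPPING HOMOMORPHISM
  `stripHom : leftSummandMp →* S̃p_ψ(W_{T₁})` (`ω(p)(f₁ ⊠ f₂) = ω(stripHom p) f₁ ⊠ f₂`, `π(stripHom p) ⊕ 1 = π p`), and
  the packaged «undoubling» of a homomorphism: for `s : G →* S̃p_ψ(W_T)` over `g ↦ φ(g) ⊕ 1`,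
  **`undouble s : G →* S̃p_ψ(W_{T₁})` lies over `φ`** and `ω(s g)(f₁ ⊠ f₂) = ω(undouble s g) f₁ ⊠ f₂` — the last step of
  the doubling construction of local splittings [GelbartRogawski1991, §3.1 Prop. 3.1.1; Kudla1994, Thm. 3.1].

## References
* [MoeglinVignerasWaldspurger1987] C. Mœglin, M.-F. Vignéras, J.-L. Waldspurger, LNM 1291 (1987), Chap. 2 I.3, II.1 Rem. (6).
* [Weil1964] A. Weil, *Sur certains groupes d'opérateurs unitaires*, Acta Math. 111 (1964), Chap. III n° 37–38.
* [GelbartRogawski1991] S. Gelbart, J. Rogawski, Invent. Math. 105 (1991), §3.1 Prop. 3.1.1 (the application).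
* [Kudla1994] S. Kudla, Israel J. Math. 87 (1994), Thm. 3.1.

## Provenance

LEAN-IN-TREE rule, pub-hodgecm stage-1 cell, seat GR-1 ≡ own-real34 (local undoubling of the cite-free
[GelbartRogawski1991, Prop. 3.1.1] package: the `FinLocalSplittings` of an undoubled unitary group).
-/

set_option autoImplicit false

noncomputable section

open scoped TensorProduct

namespace Literature.RepresentationTheory.HeisenbergGroup

open Literature.NumberTheory.Automorphic
open Literature.NumberTheory.GaloisRepresentations.IsNonarchimedeanLocalField

variable {K : Type*} [Field K] [ValuativeRel K] [TopologicalSpace K] [IsNonarchimedeanLocalField K]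

/-! ## §1 Schur for the Schrödinger model of a Gram duality -/

section Schur

variable {ι₂ : Type*} [Fintype ι₂] [DecidableEq ι₂] (T₂ : Matrix ι₂ ι₂ K) (hT₂ : IsUnit T₂.det)
  {ψ : AddChar K Circle} (hl : IsLocallyConstant (⇑ψ : K → Circle))
  (hb₂ : ∀ y : ι₂ → K, Continuous fun u : ι₂ → K => Matrix.toLinearMap₂' K T₂ u y)

include hT₂ in
/-- **Schur for `ρ_{T₂}`**: a linear endomorphism of `𝒮(K^{ι₂})` commuting with every Schrödinger operator `ρ_{T₂}(h)`
(`det T₂` a unit) is a scalar — the tree's `commutant_schrodingerSB_pi` transported along `(x, y) ↦ (x, T₂ y)`.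
[cite: MoeglinVignerasWaldspurger1987, Chap. 2 I.3] -/
theorem commutant_schrodingerSB_gram (hψ : ψ.IsContinuousNontrivial)
    (C : SchwartzBruhat (ι₂ → K) →ₗ[ℂ] SchwartzBruhat (ι₂ → K))
    (hC : ∀ (h : Heisenberg (polar (Matrix.toLinearMap₂' K T₂))) (f : SchwartzBruhat (ι₂ → K)),
      C (schrodingerSB (Matrix.toLinearMap₂' K T₂) ψ hl hb₂ h f) = schrodingerSB (Matrix.toLinearMap₂' K T₂) ψ hl hb₂ h (C f)) :
    ∃ c : ℂ, ∀ f : SchwartzBruhat (ι₂ → K), C f = c • f := by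
  refine commutant_schrodingerSB_pi hl continuous_dotProductBilin_left hψ C fun h' f => ?_
  have key := hC ((Heisenberg.mapEquiv (gramProd T₂ hT₂) (polar_dotProductBilin_gramProd T₂ hT₂)).symm h') f
  rwa [schrodingerSB_gram_eq T₂ hT₂ hl continuous_dotProductBilin_left hb₂, MulEquiv.apply_symm_apply] at key

end Schur

/-! ## §2 Stripping an implementer of `g₁ ⊕ 1` -/

section Strip

variable [Invertible (2 : K)] {ι₁ ι₂ ι : Type*} [Fintype ι₁] [Fintype ι₂] [Fintype ι]
  [DecidableEq ι₁] [DecidableEq ι₂] [DecidableEq ι]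
  (e : ι₁ ⊕ ι₂ ≃ ι) (T₁ : Matrix ι₁ ι₁ K) (T₂ : Matrix ι₂ ι₂ K) {T : Matrix ι ι K}
  (hT : T = Matrix.reindex e e (Matrix.fromBlocks T₁ 0 0 T₂)) (hT₂ : IsUnit T₂.det)
  {ψ : AddChar K Circle} (hl : IsLocallyConstant (⇑ψ : K → Circle)) (hψ : ψ.IsContinuousNontrivial)
  (hb₁ : ∀ y : ι₁ → K, Continuous fun u : ι₁ → K => Matrix.toLinearMap₂' K T₁ u y)
  (hb₂ : ∀ y : ι₂ → K, Continuous fun u : ι₂ → K => Matrix.toLinearMap₂' K T₂ u y)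
  (hb : ∀ y : ι → K, Continuous fun u : ι → K => Matrix.toLinearMap₂' K T u y)

local notation "SB" => SchwartzBruhat (ι → K)
local notation "SB₁" => SchwartzBruhat (ι₁ → K)
local notation "SB₂" => SchwartzBruhat (ι₂ → K)
local notation "ρT" => schrodingerSB (Matrix.toLinearMap₂' K T) ψ hl hb
local notation "ρ₁" => schrodingerSB (Matrix.toLinearMap₂' K T₁) ψ hl hb₁
local notation "ρ₂" => schrodingerSB (Matrix.toLinearMap₂' K T₂) ψ hl hb₂
local notation "Sp₁" => symplecticGroup (polar (Matrix.toLinearMap₂' K T₁))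
local notation "SpT" => symplecticGroup (polar (Matrix.toLinearMap₂' K T))

include hT₂ hψ hb₂ in
/-- **an implementer of `g₁ ⊕ 1` is `B₁ ⊠ 1` on products**: it commutes with `ρ_T(inrH h₂) = 1 ⊠ ρ_{T₂}(h₂)`
(`(g₁ ⊕ 1) · inrH h₂ = inrH h₂`), whose commutant is `End 𝒮(K^{ι₁}) ⊠ 1` by Schur for `ρ_{T₂}` and the algebraic
tensor-commutant lemma. [cite: MoeglinVignerasWaldspurger1987, Chap. 2 II.1 Rem. (6)] -/
theorem exists_strip_boxSB {g₁ : Sp₁} {M : SB ≃ₗ[ℂ] SB}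
    (hM : Implements ρT (ofSymplectic _ (spInl e T₁ T₂ hT g₁)) M) :
    ∃ B₁ : SB₁ →ₗ[ℂ] SB₁, ∀ (f₁ : SB₁) (f₂ : SB₂), M (boxSB K e f₁ f₂) = boxSB K e (B₁ f₁) f₂ := by
  -- the operator read on the algebraic tensor product
  obtain ⟨T', hT'app⟩ : ∃ T' : SB₁ ⊗[ℂ] SB₂ →ₗ[ℂ] SB₁ ⊗[ℂ] SB₂,
      ∀ z, T' z = (sumEquivSB K e).symm (M (sumEquivSB K e z)) :=
    ⟨(sumEquivSB K e).symm.toLinearMap ∘ₗ (M : SB →ₗ[ℂ] SB) ∘ₗ (sumEquivSB K e).toLinearMap, fun z => rfl⟩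
  -- `M` commutes with `ρ_T(inrH h₂) = 1 ⊠ ρ₂(h₂)`
  have hcommM : ∀ (h₂ : Heisenberg (polar (Matrix.toLinearMap₂' K T₂))) (Φ : SB),
      M (sumEndSB K e LinearMap.id (ρ₂ h₂) Φ) = sumEndSB K e LinearMap.id (ρ₂ h₂) (M Φ) := fun h₂ Φ => by
    rw [← schrodingerSB_inrH_eq_sumEndSB e T₁ T₂ hT hl hb₂ hb, hM, act_spInl_inrH]
  have hlT : ∀ (h₂ : Heisenberg (polar (Matrix.toLinearMap₂' K T₂))) (w : SB₁ ⊗[ℂ] SB₂),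
      LinearMap.lTensor SB₁ (ρ₂ h₂) w = (sumEquivSB K e).symm (sumEndSB K e LinearMap.id (ρ₂ h₂) (sumEquivSB K e w)) :=
    fun h₂ w => by rw [sumEquivSB_symm_sumEndSB, LinearEquiv.symm_apply_apply]; rfl
  have hcomm : ∀ s ∈ Set.range (fun h₂ : Heisenberg (polar (Matrix.toLinearMap₂' K T₂)) => ρ₂ h₂),
      T' ∘ₗ LinearMap.lTensor SB₁ s = LinearMap.lTensor SB₁ s ∘ₗ T' := by
    rintro _ ⟨h₂, rfl⟩
    refine LinearMap.ext fun z => ?_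
    rw [LinearMap.comp_apply, LinearMap.comp_apply, hT'app, hT'app, hlT, hlT, LinearEquiv.apply_symm_apply,
      LinearEquiv.apply_symm_apply, hcommM]
  -- Schur for the second factor, then the tensor-commutant lemma
  have hS : ∀ C : SB₂ →ₗ[ℂ] SB₂,
      (∀ s ∈ Set.range (fun h₂ : Heisenberg (polar (Matrix.toLinearMap₂' K T₂)) => ρ₂ h₂), C ∘ₗ s = s ∘ₗ C) →
        ∃ c : ℂ, C = c • LinearMap.id := fun C hC => by
    obtain ⟨c, hc⟩ := commutant_schrodingerSB_gram T₂ hT₂ hl hb₂ hψ C fun h₂ f =>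
      LinearMap.congr_fun (hC _ ⟨h₂, rfl⟩) f
    exact ⟨c, LinearMap.ext fun f => by rw [hc, LinearMap.smul_apply, LinearMap.id_apply]⟩
  obtain ⟨B₁, hB₁⟩ := Literature.LinearAlgebra.exists_tmul_eq_of_commute_lTensor hS T' hcomm
  refine ⟨B₁, fun f₁ f₂ => ?_⟩
  have h := hB₁ f₁ f₂
  rw [hT'app, LinearEquiv.symm_apply_eq] at h
  exact h

include hT₂ hψ hb₂ in
/-- **SUM-STRIPPING AT A FINITE PLACE.** Let `(G, M) ∈ S̃p_ψ(W_T)` lie over `G = g₁ ⊕ 1`. Then there is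
`(g₁, M₁) ∈ S̃p_ψ(W_{T₁})` — an implementer of `g₁` on `𝒮(K^{ι₁})` — with `M (f₁ ⊠ f₂) = M₁ f₁ ⊠ f₂` for all `f₁, f₂`:
the restriction of the metaplectic representation of `W_{T₁} ⊕ W_{T₂}` to the first summand is `ω₁ ⊠ 1`.
[cite: MoeglinVignerasWaldspurger1987, Chap. 2 II.1 Rem. (6); Weil1964, Chap. III n° 37–38 pp. 188–190] -/
theorem exists_strip_of_proj_eq_spInl (p : MpPsi ρT) (g₁ : Sp₁)
    (hG : (p : SpT × (SB ≃ₗ[ℂ] SB)).1 = spInl e T₁ T₂ hT g₁) :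
    ∃ p₁ : MpPsi ρ₁, (p₁ : Sp₁ × (SB₁ ≃ₗ[ℂ] SB₁)).1 = g₁ ∧
      ∀ (f₁ : SB₁) (f₂ : SB₂), (p : SpT × (SB ≃ₗ[ℂ] SB)).2 (boxSB K e f₁ f₂) =
        boxSB K e ((p₁ : Sp₁ × (SB₁ ≃ₗ[ℂ] SB₁)).2 f₁) f₂ := by
  have hImp : Implements ρT (ofSymplectic _ (spInl e T₁ T₂ hT g₁)) (p : SpT × (SB ≃ₗ[ℂ] SB)).2 := by
    have h := (mem_MpPsi _ _).1 p.2
    rwa [hG] at h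
  have hImp' : Implements ρT (ofSymplectic _ (spInl e T₁ T₂ hT g₁⁻¹)) ((p⁻¹ : MpPsi ρT) : SpT × (SB ≃ₗ[ℂ] SB)).2 := by
    have h := (mem_MpPsi _ _).1 (p⁻¹).2
    rwa [Subgroup.coe_inv, Prod.fst_inv, hG, ← map_inv] at h
  obtain ⟨N, hN⟩ := exists_strip_boxSB e T₁ T₂ hT hT₂ hl hψ hb₂ hb hImp
  obtain ⟨N', hN'⟩ := exists_strip_boxSB e T₁ T₂ hT hT₂ hl hψ hb₂ hb hImp'
  obtain ⟨f₂, hf₂⟩ := exists_schwartzBruhat_pi_ne_zero K ι₂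
  -- `M⁻¹ M = 1 = M M⁻¹` strip to `N' N = 1 = N N'`
  have h₁ : N' ∘ₗ N = LinearMap.id := by
    refine LinearMap.ext fun f₁ => boxSB_left_cancel K e hf₂ ?_
    rw [LinearMap.comp_apply, LinearMap.id_apply, ← hN', ← hN, ← LinearEquiv.mul_apply, ← Prod.snd_mul,
      ← Subgroup.coe_mul, inv_mul_cancel, OneMemClass.coe_one, Prod.snd_one, LinearEquiv.coe_one, id_eq]
  have h₂ : N ∘ₗ N' = LinearMap.id := by
    refine LinearMap.ext fun f₁ => boxSB_left_cancel K e hf₂ ?_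
    rw [LinearMap.comp_apply, LinearMap.id_apply, ← hN, ← hN', ← LinearEquiv.mul_apply, ← Prod.snd_mul,
      ← Subgroup.coe_mul, mul_inv_cancel, OneMemClass.coe_one, Prod.snd_one, LinearEquiv.coe_one, id_eq]
  let M₁ : SB₁ ≃ₗ[ℂ] SB₁ := LinearEquiv.ofLinear N N' h₂ h₁
  -- `(g₁, M₁)` implements `g₁` on `H(W_{T₁})`
  have hmem : ((g₁, M₁) : Sp₁ × (SB₁ ≃ₗ[ℂ] SB₁)) ∈ MpPsi ρ₁ := by
    rw [mem_MpPsi]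
    intro h₁ f₁
    refine boxSB_left_cancel K e hf₂ ?_
    change boxSB K e (N (ρ₁ h₁ f₁)) f₂ = boxSB K e (ρ₁ ((ofSymplectic _ g₁).act h₁) (N f₁)) f₂
    rw [← hN, ← schrodingerSB_inlH_boxSB e T₁ T₂ hT hl hb₁ hb, hImp, act_spInl_inlH, hN,
      schrodingerSB_inlH_boxSB e T₁ T₂ hT hl hb₁ hb]
  exact ⟨⟨(g₁, M₁), hmem⟩, rfl, fun f₁ f₂' => hN f₁ f₂'⟩

omit [Invertible (2 : K)] [DecidableEq ι₁] [DecidableEq ι₂] [DecidableEq ι] in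
/-- **uniqueness of the stripped operator**: `M₁` is determined by `M (f₁ ⊠ f₂) = M₁ f₁ ⊠ f₂` for one `f₂ ≠ 0`.
[cite: MoeglinVignerasWaldspurger1987, Chap. 2 II.1 Rem. (6)] -/
theorem strip_unique {M₁ M₁' : SB₁ →ₗ[ℂ] SB₁} {f₂ : SB₂} (hf₂ : f₂ ≠ 0)
    (h : ∀ f₁ : SB₁, boxSB K e (M₁ f₁) f₂ = boxSB K e (M₁' f₁) f₂) : M₁ = M₁' :=
  LinearMap.ext fun f₁ => boxSB_left_cancel K e hf₂ (h f₁)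

/-! ## §3 The stripping homomorphism and the undoubling of a homomorphism -/

/-- **the pairs of `S̃p_ψ(W_T)` over `Sp(W_{T₁}) ⊕ 1`.** [cite: Kudla1984, §1] -/
def leftSummandMp : Subgroup (MpPsi ρT) := (spInl e T₁ T₂ hT).range.comap (MpPsi.proj ρT)

/-- membership: `p` lies over some `g₁ ⊕ 1`. [cite: Kudla1984, §1] -/
theorem mem_leftSummandMp_iff (p : MpPsi ρT) :
    p ∈ leftSummandMp e T₁ T₂ hT hl hb ↔ ∃ g₁ : Sp₁, spInl e T₁ T₂ hT g₁ = MpPsi.proj ρT p := by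
  simp only [leftSummandMp, Subgroup.mem_comap, MonoidHom.mem_range]

/-- the first block `g₁` of `π p = g₁ ⊕ 1` (unique, `spInl` being injective). [cite: Kudla1984, §1] -/
def leftProj (p : leftSummandMp e T₁ T₂ hT hl hb) : Sp₁ :=
  Classical.choose ((mem_leftSummandMp_iff e T₁ T₂ hT hl hb _).1 p.2)

/-- `leftProj p ⊕ 1 = π p`. [cite: Kudla1984, §1] -/
theorem spInl_leftProj (p : leftSummandMp e T₁ T₂ hT hl hb) :
    spInl e T₁ T₂ hT (leftProj e T₁ T₂ hT hl hb p) = MpPsi.proj ρT (p : MpPsi ρT) :=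
  Classical.choose_spec ((mem_leftSummandMp_iff e T₁ T₂ hT hl hb _).1 p.2)

include hT₂ hψ hb₂ in
/-- existence of the stripped pair for `p ∈ leftSummandMp`. [cite: MoeglinVignerasWaldspurger1987, Chap. 2 II.1 Rem. (6)] -/
theorem strip_exists (p : leftSummandMp e T₁ T₂ hT hl hb) :
    ∃ p₁ : MpPsi ρ₁, (p₁ : Sp₁ × (SB₁ ≃ₗ[ℂ] SB₁)).1 = leftProj e T₁ T₂ hT hl hb p ∧
      ∀ (f₁ : SB₁) (f₂ : SB₂), ((p : MpPsi ρT) : SpT × (SB ≃ₗ[ℂ] SB)).2 (boxSB K e f₁ f₂) =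
        boxSB K e ((p₁ : Sp₁ × (SB₁ ≃ₗ[ℂ] SB₁)).2 f₁) f₂ :=
  exists_strip_of_proj_eq_spInl e T₁ T₂ hT hT₂ hl hψ hb₁ hb₂ hb _ _ (spInl_leftProj e T₁ T₂ hT hl hb p).symm

/-- **the stripped pair** `strip p ∈ S̃p_ψ(W_{T₁})` of `p ∈ leftSummandMp` (a choice, pinned by `eq_strip`).
[cite: MoeglinVignerasWaldspurger1987, Chap. 2 II.1 Rem. (6)] -/
def strip (p : leftSummandMp e T₁ T₂ hT hl hb) : MpPsi ρ₁ :=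
  Classical.choose (strip_exists e T₁ T₂ hT hT₂ hl hψ hb₁ hb₂ hb p)

/-- `π(strip p) = leftProj p`. [cite: MoeglinVignerasWaldspurger1987, Chap. 2 II.1 Rem. (6)] -/
theorem proj_strip (p : leftSummandMp e T₁ T₂ hT hl hb) :
    MpPsi.proj ρ₁ (strip e T₁ T₂ hT hT₂ hl hψ hb₁ hb₂ hb p) = leftProj e T₁ T₂ hT hl hb p :=
  (Classical.choose_spec (strip_exists e T₁ T₂ hT hT₂ hl hψ hb₁ hb₂ hb p)).1

/-- **`π(strip p) ⊕ 1 = π p`.** [cite: Kudla1984, §1] -/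
theorem spInl_proj_strip (p : leftSummandMp e T₁ T₂ hT hl hb) :
    spInl e T₁ T₂ hT (MpPsi.proj ρ₁ (strip e T₁ T₂ hT hT₂ hl hψ hb₁ hb₂ hb p)) = MpPsi.proj ρT (p : MpPsi ρT) := by
  rw [proj_strip, spInl_leftProj]

/-- **`ω(p)(f₁ ⊠ f₂) = ω(strip p) f₁ ⊠ f₂`.** [cite: MoeglinVignerasWaldspurger1987, Chap. 2 II.1 Rem. (6)] -/
theorem toRep_apply_boxSB (p : leftSummandMp e T₁ T₂ hT hl hb) (f₁ : SB₁) (f₂ : SB₂) :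
    MpPsi.toRep ρT (p : MpPsi ρT) (boxSB K e f₁ f₂) =
      boxSB K e (MpPsi.toRep ρ₁ (strip e T₁ T₂ hT hT₂ hl hψ hb₁ hb₂ hb p) f₁) f₂ := by
  rw [MpPsi.toRep_apply, MpPsi.toRep_apply]
  exact (Classical.choose_spec (strip_exists e T₁ T₂ hT hT₂ hl hψ hb₁ hb₂ hb p)).2 f₁ f₂

include hT₂ hψ hb₂ in
/-- **uniqueness of the stripped pair**: any `q ∈ S̃p_ψ(W_{T₁})` with `π q ⊕ 1 = π p` and
`ω(p)(f₁ ⊠ f₂) = ω(q) f₁ ⊠ f₂` is `strip p`. [cite: MoeglinVignerasWaldspurger1987, Chap. 2 II.1 Rem. (6)] -/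
theorem eq_strip (p : leftSummandMp e T₁ T₂ hT hl hb) (q : MpPsi ρ₁)
    (hq : spInl e T₁ T₂ hT (MpPsi.proj ρ₁ q) = MpPsi.proj ρT (p : MpPsi ρT))
    (hω : ∀ (f₁ : SB₁) (f₂ : SB₂), MpPsi.toRep ρT (p : MpPsi ρT) (boxSB K e f₁ f₂) = boxSB K e (MpPsi.toRep ρ₁ q f₁) f₂) :
    q = strip e T₁ T₂ hT hT₂ hl hψ hb₁ hb₂ hb p := by
  obtain ⟨f₂, hf₂⟩ := exists_schwartzBruhat_pi_ne_zero K ι₂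
  have h1 : MpPsi.proj ρ₁ q = MpPsi.proj ρ₁ (strip e T₁ T₂ hT hT₂ hl hψ hb₁ hb₂ hb p) :=
    spInl_injective e T₁ T₂ hT (hq.trans (spInl_proj_strip e T₁ T₂ hT hT₂ hl hψ hb₁ hb₂ hb p).symm)
  have h2 : ((q : Sp₁ × (SB₁ ≃ₗ[ℂ] SB₁)).2 : SB₁ →ₗ[ℂ] SB₁) =
      ((strip e T₁ T₂ hT hT₂ hl hψ hb₁ hb₂ hb p : Sp₁ × (SB₁ ≃ₗ[ℂ] SB₁)).2 : SB₁ →ₗ[ℂ] SB₁) := by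
    refine strip_unique e hf₂ fun f₁ => ?_
    rw [LinearEquiv.coe_coe, LinearEquiv.coe_coe, ← MpPsi.toRep_apply, ← MpPsi.toRep_apply, ← hω,
      toRep_apply_boxSB e T₁ T₂ hT hT₂ hl hψ hb₁ hb₂ hb]
  exact Subtype.ext (Prod.ext h1 (LinearEquiv.toLinearMap_injective h2))

include hT₂ hψ hb₂ in
/-- `strip (p q) = strip p · strip q` (uniqueness). [cite: MoeglinVignerasWaldspurger1987, Chap. 2 II.1 Rem. (6)] -/
theorem strip_mul (p q : leftSummandMp e T₁ T₂ hT hl hb) :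
    strip e T₁ T₂ hT hT₂ hl hψ hb₁ hb₂ hb (p * q) =
      strip e T₁ T₂ hT hT₂ hl hψ hb₁ hb₂ hb p * strip e T₁ T₂ hT hT₂ hl hψ hb₁ hb₂ hb q := by
  symm
  refine eq_strip e T₁ T₂ hT hT₂ hl hψ hb₁ hb₂ hb _ _ ?_ fun f₁ f₂ => ?_
  · -- projection side: `(π(strip p) π(strip q)) ⊕ 1 = π(p q)`
    have e1 := (MpPsi.proj ρ₁).map_mul (strip e T₁ T₂ hT hT₂ hl hψ hb₁ hb₂ hb p)
      (strip e T₁ T₂ hT hT₂ hl hψ hb₁ hb₂ hb q)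
    exact (congrArg (spInl e T₁ T₂ hT) e1).trans ((((spInl e T₁ T₂ hT).map_mul _ _).trans
      (congrArg₂ (· * ·) (spInl_proj_strip e T₁ T₂ hT hT₂ hl hψ hb₁ hb₂ hb p)
        (spInl_proj_strip e T₁ T₂ hT hT₂ hl hψ hb₁ hb₂ hb q))).trans ((MpPsi.proj ρT).map_mul _ _).symm)
  · -- operator side
    have h1 := LinearMap.congr_fun ((MpPsi.toRep ρT).map_mul (p : MpPsi ρT) (q : MpPsi ρT)) (boxSB K e f₁ f₂)
    have h2 := LinearMap.congr_fun ((MpPsi.toRep ρ₁).map_mul (strip e T₁ T₂ hT hT₂ hl hψ hb₁ hb₂ hb p)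
      (strip e T₁ T₂ hT hT₂ hl hψ hb₁ hb₂ hb q)) f₁
    refine h1.trans ?_
    rw [h2, Module.End.mul_apply, Module.End.mul_apply, toRep_apply_boxSB e T₁ T₂ hT hT₂ hl hψ hb₁ hb₂ hb q,
      toRep_apply_boxSB e T₁ T₂ hT hT₂ hl hψ hb₁ hb₂ hb p]

/-- **THE STRIPPING HOMOMORPHISM `leftSummandMp →* S̃p_ψ(W_{T₁})`.** [cite: MoeglinVignerasWaldspurger1987, Chap. 2 II.1 Rem. (6)] -/
def stripHom : leftSummandMp e T₁ T₂ hT hl hb →* MpPsi ρ₁ :=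
  MonoidHom.mk' (strip e T₁ T₂ hT hT₂ hl hψ hb₁ hb₂ hb) (strip_mul e T₁ T₂ hT hT₂ hl hψ hb₁ hb₂ hb)

/-- unfolding. [cite: MoeglinVignerasWaldspurger1987, Chap. 2 II.1 Rem. (6)] -/
@[simp] theorem stripHom_apply (p : leftSummandMp e T₁ T₂ hT hl hb) :
    stripHom e T₁ T₂ hT hT₂ hl hψ hb₁ hb₂ hb p = strip e T₁ T₂ hT hT₂ hl hψ hb₁ hb₂ hb p := rfl

/-! ### undoubling a homomorphism over `g ↦ φ(g) ⊕ 1` -/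

variable {G : Type*} [Group G] (φ : G →* symplecticGroup (polar (Matrix.toLinearMap₂' K T₁)))
  (s : G →* MpPsi (schrodingerSB (Matrix.toLinearMap₂' K T) ψ hl hb))
  (hs : ∀ g : G, MpPsi.proj (schrodingerSB (Matrix.toLinearMap₂' K T) ψ hl hb) (s g) = spInl e T₁ T₂ hT (φ g))

include hs in
/-- `s` takes values in `leftSummandMp`. [cite: Kudla1984, §1] -/
theorem mem_leftSummandMp_of_proj_eq (g : G) : s g ∈ leftSummandMp e T₁ T₂ hT hl hb :=
  (mem_leftSummandMp_iff e T₁ T₂ hT hl hb _).2 ⟨φ g, (hs g).symm⟩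

/-- **UNDOUBLING**: a homomorphism `s : G →* S̃p_ψ(W_T)` over `g ↦ φ(g) ⊕ 1` strips to `G →* S̃p_ψ(W_{T₁})`
(`stripHom ∘ s`). [cite: GelbartRogawski1991, §3.1 Prop. 3.1.1 p. 455 L1–3] -/
def undouble : G →* MpPsi ρ₁ :=
  (stripHom e T₁ T₂ hT hT₂ hl hψ hb₁ hb₂ hb).comp
    (s.codRestrict (leftSummandMp e T₁ T₂ hT hl hb) (mem_leftSummandMp_of_proj_eq e T₁ T₂ hT hl hb φ s hs))

/-- **`undouble s` lies over `φ`**: `π(undouble s g) = φ(g)`. [cite: GelbartRogawski1991, §3.1 Prop. 3.1.1 p. 455 L1–3] -/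
theorem proj_undouble (g : G) :
    MpPsi.proj ρ₁ (undouble e T₁ T₂ hT hT₂ hl hψ hb₁ hb₂ hb φ s hs g) = φ g := by
  refine spInl_injective e T₁ T₂ hT ?_
  rw [undouble, MonoidHom.comp_apply, stripHom_apply, spInl_proj_strip, MonoidHom.codRestrict_apply, hs]

/-- **`ω(s g)(f₁ ⊠ f₂) = ω(undouble s g) f₁ ⊠ f₂`**: the representation along `s`, restricted to the first variables,
IS the representation along `undouble s` (times the identity on the second). [cite: MoeglinVignerasWaldspurger1987, Chap. 2 II.1 Rem. (6)] -/
theorem toRep_apply_boxSB_undouble (g : G) (f₁ : SB₁) (f₂ : SB₂) :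
    MpPsi.toRep ρT (s g) (boxSB K e f₁ f₂) =
      boxSB K e (MpPsi.toRep ρ₁ (undouble e T₁ T₂ hT hT₂ hl hψ hb₁ hb₂ hb φ s hs g) f₁) f₂ := by
  rw [undouble, MonoidHom.comp_apply, stripHom_apply, ← toRep_apply_boxSB, MonoidHom.codRestrict_apply]

end Strip

end Literature.RepresentationTheory.HeisenbergGroup

end
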